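import Literature.AnabelianGeometry.AbsoluteAnabelian.MLFGaloisModel

/-!
# MLF-Galois `T`-pairs, mono-analytic type, morphisms, and the log-Frobenius operation on pairs
# ([AbsTopIII] Definition 3.1 (i), (ii), (iv) — second file)

Continuation of `MLFGaloisModel.lean` (statements-first typing, D-0014, of S. Mochizuki, *Topics in
absolute anabelian geometry III*, §3 Def 3.1; bib key `MochizukiAbsTopIII2015`; locators = kurims
manuscript pages, lit key `paper:url-5493eb38cbb7`).

* Def 3.1 (i) pp.66–67 — the type index `PairType` (`TF, TCG, TLG, TM, TS, TS⊞`), torsion-cyclotomic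
  monoids, abstract pairs `(Π ↷ M)` (`GaloisFieldPair` for `TF`, `GaloisMonoidPair` for
  `TCG/TLG/TM`; per Rmk 3.1.1 p.70 the arithmetic data carry no topology / ind-structure, the
  continuity of the action being recorded as openness of point stabilisers), their isomorphisms,
  and the MODEL pairs of a `ModelMLFGaloisData` (`fieldPair`: `Π_k ↷ k̄`; `monoidPair`: `Π_k ↷ 𝒪_k̄^×`,
  `k̄^× = nonZeroDivisors k̄`, `𝒪_k̄^⊳`), with the openness of stabilisers PROVED from the Krull topology;
* Def 3.1 (ii) p.67 — `IsMLFGaloisFieldPair` / `IsMLFGaloisMonoidPair` (isomorphic to a model), "of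
  mono-analytic type", the arithmetic Galois group (kernel form `actionKer`), morphisms of pairs
  (`φ_M` + compatible continuous `φ_Π` inducing an open injection on arithmetic Galois groups),
  `T`-isomorphisms and Galois-isomorphisms;
* Def 3.1 (iv) pp.68–69 — the output of the log-Frobenius operation on a model `TF`-pair as the pair
  together with its pre-log-shell (`LogFrobeniusOutput`).

Also: `GaloisSpacePair` / `IsMLFGaloisSpacePair` for `T = TS` and `GaloisLCAPair` / `IsMLFGaloisLCAPair`
for `T = TS⊞` ("any object … equipped with a faithful continuous `G_k`-action").
Deliberately NOT here: "of hyperbolic orbicurve type" / "of strictly Belyi type" (the condition that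
`Π_k ↠ G_k` "arises from the étale fundamental group of a hyperbolic orbicurve (of strictly Belyi
type)" is scheme-theoretic: typed over the π₁-interface of seat abc-iut-L4-t1 with Prop 3.2), Def 3.1
(iii) categories (file `MLFGaloisCategories`) and functors, (vi) `Anab`.
-/

namespace Literature.AnabelianGeometry.AbsoluteAnabelian

open _root_.Topology
open scoped _root_.ValuativeRel

universe u

noncomputable section

/-! ### Definition 3.1 (i)/(ii): types `T`, pairs `(Π ↷ M)`, model pairs, MLF-Galois pairs -/

/-- The six "types" `T ∈ {TF, TCG, TLG, TM, TS, TS⊞}` of arithmetic data of Def 3.1 (i) (ind-topological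
fields; torsion-cyclotomic ind-compact / ind-locally compact abelian groups; torsion-cyclotomic
ind-topological abelian monoids; ind-locally compact spaces / abelian topological groups).
[cite: MochizukiAbsTopIII2015, Definition 3.1 (i) p.66] -/
inductive PairType
  | TF | TCG | TLG | TM | TS | TSadd
  deriving DecidableEq

/-- An abelian monoid is **torsion-cyclotomic** if "its subgroup of torsion elements is
[abstractly] isomorphic to `ℚ/ℤ`" (`ℚ/ℤ` = Mathlib `AddCircle (1 : ℚ)`, written
multiplicatively).
[cite: MochizukiAbsTopIII2015, Definition 3.1 (i) p.66] -/
@[mk_iff]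
structure IsTorsionCyclotomic (M : Type u) [CommMonoid M] : Prop where
  nonempty_equiv : Nonempty (CommMonoid.torsion M ≃* Multiplicative (AddCircle (1 : ℚ)))

/-- An abstract pair `(Π ↷ M)` for `T = TF`: "a topological group `Π`, an object `M ∈ Ob(T)`"
— here a field — "and a continuous action of `Π` on `M`" by field automorphisms (the topology on
`M` is omitted, Rmk 3.1.1 p.70; continuity of the action is recorded as the requirement that
point stabilisers are open, i.e. continuity for the discrete topology on `M`).
[cite: MochizukiAbsTopIII2015, Definition 3.1 (ii) p.67] -/
structure GaloisFieldPair : Type (u + 1) where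
  Pi : Type u
  [instGroup : Group Pi]
  [instTop : TopologicalSpace Pi]
  [instTopGroup : IsTopologicalGroup Pi]
  M : Type u
  [instField : Field M]
  [instAction : MulSemiringAction Pi M]
  isOpen_stabilizer : ∀ x : M, IsOpen (MulAction.stabilizer Pi x : Set Pi)

attribute [instance] GaloisFieldPair.instGroup GaloisFieldPair.instTop
  GaloisFieldPair.instTopGroup GaloisFieldPair.instField GaloisFieldPair.instAction

/-- An abstract pair `(Π ↷ M)` for `T ∈ {TCG, TLG, TM}`: a topological group `Π`, an abelian
monoid `M` (a group for `TCG`, `TLG`) and an action of `Π` on `M` by monoid automorphisms with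
open point stabilisers (topology on `M` omitted, Rmk 3.1.1 p.70).
[cite: MochizukiAbsTopIII2015, Definition 3.1 (ii) p.67] -/
structure GaloisMonoidPair : Type (u + 1) where
  Pi : Type u
  [instGroup : Group Pi]
  [instTop : TopologicalSpace Pi]
  [instTopGroup : IsTopologicalGroup Pi]
  M : Type u
  [instMonoid : CommMonoid M]
  [instAction : MulDistribMulAction Pi M]
  isOpen_stabilizer : ∀ x : M, IsOpen (MulAction.stabilizer Pi x : Set Pi)

attribute [instance] GaloisMonoidPair.instGroup GaloisMonoidPair.instTop
  GaloisMonoidPair.instTopGroup GaloisMonoidPair.instMonoid GaloisMonoidPair.instAction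

/-- An isomorphism of `TF`-pairs: "an isomorphism of topological groups `Π_k ⥲ Π` and an isomorphism of
objects `M_k̄ ⥲ M` of `T` that are compatible with the respective actions".
[cite: MochizukiAbsTopIII2015, Definition 3.1 (ii) p.67] -/
structure GaloisFieldPair.Iso (P Q : GaloisFieldPair.{u}) : Type u where
  isoPi : P.Pi ≃ₜ* Q.Pi
  isoM : P.M ≃+* Q.M
  smul_comm : ∀ (g : P.Pi) (x : P.M), isoM (g • x) = isoPi g • isoM x

/-- An isomorphism of `TCG/TLG/TM`-pairs. [cite: MochizukiAbsTopIII2015, Definition 3.1 (ii) p.67] -/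
structure GaloisMonoidPair.Iso (P Q : GaloisMonoidPair.{u}) : Type u where
  isoPi : P.Pi ≃ₜ* Q.Pi
  isoM : P.M ≃* Q.M
  smul_comm : ∀ (g : P.Pi) (x : P.M), isoM (g • x) = isoPi g • isoM x

section ModelPairs

variable {k : Type u} [Field k] {K : Type u} [Field K] [Algebra k K]

/-- Stabilisers of the `Π_k`-action on `k̄` through `ε_k` are open (the Krull topology is the
topology of pointwise stabilisers and `ε_k` is continuous).
[cite: MochizukiAbsTopIII2015, Definition 3.1 (i) p.66] -/
theorem ModelMLFGaloisData.isOpen_stabilizer_comp [Algebra.IsAlgebraic k K]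
    (D : ModelMLFGaloisData k K) (x : K) :
    IsOpen ((MulAction.stabilizer (K ≃ₐ[k] K) x : Set (K ≃ₐ[k] K)).preimage D.aug) := by
  refine (IsOpen.preimage D.continuous_aug ?_)
  haveI : FiniteDimensional k (IntermediateField.adjoin k {x}) :=
    IntermediateField.adjoin.finiteDimensional (Algebra.IsAlgebraic.isAlgebraic x).isIntegral
  have h : IsOpen ((IntermediateField.adjoin k {x}).fixingSubgroup : Set (K ≃ₐ[k] K)) :=
    IntermediateField.fixingSubgroup_isOpen (IntermediateField.adjoin k {x})
  apply isOpen_iff_mem_nhds.mpr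
  intro σ hσ
  have hσx : σ x = x := hσ
  have : (fun τ => σ * τ) '' ((IntermediateField.adjoin k {x}).fixingSubgroup : Set (K ≃ₐ[k] K))
      ⊆ (MulAction.stabilizer (K ≃ₐ[k] K) x : Set (K ≃ₐ[k] K)) := by
    rintro _ ⟨τ, hτ, rfl⟩
    show (σ * τ) • x = x
    have hτx : τ x = x := by
      have := (IntermediateField.mem_fixingSubgroup_iff _ _).mp hτ x
        (IntermediateField.subset_adjoin k {x} (Set.mem_singleton x))
      exact this
    simp [AlgEquiv.smul_def, hτx, hσx]
  refine Filter.mem_of_superset ?_ this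
  have hopen : IsOpen ((fun τ => σ * τ) ''
      ((IntermediateField.adjoin k {x}).fixingSubgroup : Set (K ≃ₐ[k] K))) :=
    (Homeomorph.mulLeft σ).isOpenMap _ h
  exact hopen.mem_nhds ⟨1, Subgroup.one_mem _, mul_one σ⟩

variable [Algebra.IsAlgebraic k K]

/-- The **model MLF-Galois `TF`-pair** `(Π_k ↷ k̄)`: `Π_k` acting on `M_k̄ = k̄` through `ε_k`.
[cite: MochizukiAbsTopIII2015, Definition 3.1 (i) p.67] -/
def ModelMLFGaloisData.fieldPair (D : ModelMLFGaloisData k K) : GaloisFieldPair.{u} where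
  Pi := D.Pi
  M := K
  instAction := MulSemiringAction.compHom K D.aug
  isOpen_stabilizer x := by
    convert D.isOpen_stabilizer_comp x using 1
    ext σ
    exact Iff.rfl

/-- The action of `Π_k` through `ε_k` on a `G_k`-stable submonoid `S ⊆ k̄` by monoid
automorphisms (used for `S = 𝒪_k̄^⊳`, `𝒪_k̄^×`, `k̄^×`).
[cite: MochizukiAbsTopIII2015, Definition 3.1 (i) p.67] -/
@[reducible] def ModelMLFGaloisData.submonoidAction (D : ModelMLFGaloisData k K)
    (S : Submonoid K) (hS : ∀ (σ : K ≃ₐ[k] K) {x : K}, x ∈ S → σ • x ∈ S) :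
    MulDistribMulAction D.Pi S where
  smul g x := ⟨D.aug g • (x : K), hS _ x.2⟩
  one_smul x := Subtype.ext (by
    change D.aug 1 • (x : K) = x
    rw [map_one, one_smul])
  mul_smul g h x := Subtype.ext (by
    change D.aug (g * h) • (x : K) = D.aug g • (D.aug h • (x : K))
    rw [map_mul, mul_smul])
  smul_mul g x y := Subtype.ext (by
    change D.aug g • ((x : K) * y) = D.aug g • (x : K) * D.aug g • (y : K)
    exact smul_mul' _ _ _)
  smul_one g := Subtype.ext (by
    change D.aug g • (1 : K) = 1
    exact smul_one _)

/-- The **model MLF-Galois `T`-pair** for `T ∈ {TCG, TLG, TM}`: `Π_k` acting through `ε_k` on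
`M_k̄ = 𝒪_k̄^×` (`TCG`), `k̄^×` (`TLG`), `𝒪_k̄^⊳` (`TM`).  (For `T = TF` see
`ModelMLFGaloisData.fieldPair`; `TS`, `TS⊞` have no canonical model object.)
[cite: MochizukiAbsTopIII2015, Definition 3.1 (i) p.67] -/
def ModelMLFGaloisData.monoidPair [ValuativeRel k] (D : ModelMLFGaloisData k K) :
    PairType → Option GaloisMonoidPair.{u}
  | .TCG => some
      { Pi := D.Pi, M := unitSubmonoid k K
        instAction := D.submonoidAction (unitSubmonoid k K) (fun σ _ h => smul_mem_unitSubmonoid σ h)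
        isOpen_stabilizer := fun x => by
          convert D.isOpen_stabilizer_comp (x : K) using 1
          ext σ
          exact Subtype.ext_iff }
  | .TLG => some
      { Pi := D.Pi, M := nonZeroDivisors K
        instAction := D.submonoidAction (nonZeroDivisors K)
          (fun σ _ h => smul_mem_nonZeroDivisors σ h)
        isOpen_stabilizer := fun x => by
          convert D.isOpen_stabilizer_comp (x : K) using 1
          ext σ
          exact Subtype.ext_iff }
  | .TM => some
      { Pi := D.Pi, M := nonzeroIntegers k K
        instAction := D.submonoidAction (nonzeroIntegers k K)
          (fun σ _ h => smul_mem_nonzeroIntegers σ h)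
        isOpen_stabilizer := fun x => by
          convert D.isOpen_stabilizer_comp (x : K) using 1
          ext σ
          exact Subtype.ext_iff }
  | _ => none

end ModelPairs

/-- An abstract pair `(Π ↷ M)` for `T = TS`: a topological group `Π` acting continuously on an
(ind-)locally compact topological space `M`.  For this type the topology IS part of the data
(Rmk 3.1.1 only removes it for `TF, TCG, TLG, TM`).
[cite: MochizukiAbsTopIII2015, Definition 3.1 (i) pp.66–67] -/
structure GaloisSpacePair : Type (u + 1) where
  Pi : Type u
  [instGroup : Group Pi]
  [instTop : TopologicalSpace Pi]
  [instTopGroup : IsTopologicalGroup Pi]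
  M : Type u
  [instTopM : TopologicalSpace M]
  [instLC : LocallyCompactSpace M]
  [instAction : MulAction Pi M]
  continuous_smul : Continuous fun p : Pi × M => p.1 • p.2

attribute [instance] GaloisSpacePair.instGroup GaloisSpacePair.instTop GaloisSpacePair.instTopGroup
  GaloisSpacePair.instTopM GaloisSpacePair.instLC GaloisSpacePair.instAction

/-- An abstract pair `(Π ↷ M)` for `T = TS⊞`: `M` an (ind-)locally compact ABELIAN TOPOLOGICAL GROUP and
`Π` acting continuously by group automorphisms.
[cite: MochizukiAbsTopIII2015, Definition 3.1 (i) pp.66–67] -/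
structure GaloisLCAPair : Type (u + 1) where
  Pi : Type u
  [instGroup : Group Pi]
  [instTop : TopologicalSpace Pi]
  [instTopGroup : IsTopologicalGroup Pi]
  M : Type u
  [instGrpM : CommGroup M]
  [instTopM : TopologicalSpace M]
  [instTopGrpM : IsTopologicalGroup M]
  [instLC : LocallyCompactSpace M]
  [instAction : MulDistribMulAction Pi M]
  continuous_smul : Continuous fun p : Pi × M => p.1 • p.2

attribute [instance] GaloisLCAPair.instGroup GaloisLCAPair.instTop GaloisLCAPair.instTopGroup
  GaloisLCAPair.instGrpM GaloisLCAPair.instTopM GaloisLCAPair.instTopGrpM GaloisLCAPair.instLC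
  GaloisLCAPair.instAction

/-- The underlying `TS`-pair of a `TS⊞`-pair ("natural full embedding `TS⊞ ↪ TS`"). [cite: MochizukiAbsTopIII2015, Definition 3.1 (i) p.66] -/
def GaloisLCAPair.toSpacePair (P : GaloisLCAPair.{u}) : GaloisSpacePair.{u} where
  Pi := P.Pi
  M := P.M
  instAction := inferInstance
  continuous_smul := P.continuous_smul

section SpacePairs

variable {k : Type u} [Field k] {K : Type u} [Field K] [Algebra k K]

/-- **Def 3.1 (i)/(ii) for `T = TS`**: the model object is "any object of `TS` equipped with a faithful
continuous `G_k`-action"; so `(Π ↷ M)` is an MLF-Galois `TS`-pair iff, for some model data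
`(k, k̄, Π_k ↠ G_k)`, `Π ≅ Π_k` as topological groups and the action of `Π` on `M` is pulled back along
`ε_k` from a FAITHFUL CONTINUOUS action of `G_k` (Krull topology).
[cite: MochizukiAbsTopIII2015, Definition 3.1 (ii) p.67] -/
@[mk_iff]
structure IsMLFGaloisSpacePair (P : GaloisSpacePair.{u}) : Prop where
  exists_model : ∃ (C : MLFClosure.{u}) (D : ModelMLFGaloisData C.k C.K) (e : D.Pi ≃ₜ* P.Pi)
    (act : (C.K ≃ₐ[C.k] C.K) → P.M → P.M),
    Continuous (fun p : (C.K ≃ₐ[C.k] C.K) × P.M => act p.1 p.2) ∧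
    (∀ (g : D.Pi) (m : P.M), e g • m = act (D.aug g) m) ∧
    ∀ σ : C.K ≃ₐ[C.k] C.K, (∀ m : P.M, act σ m = m) → σ = 1

/-- **Def 3.1 (i)/(ii) for `T = TS⊞`**: as for `TS`, through the underlying `TS`-pair. [cite: MochizukiAbsTopIII2015, Definition 3.1 (ii) p.67] -/
def IsMLFGaloisLCAPair (P : GaloisLCAPair.{u}) : Prop := IsMLFGaloisSpacePair P.toSpacePair

end SpacePairs

/-! ### Definition 3.1 (ii): MLF-Galois `T`-pairs, mono-analytic type, morphisms -/

/-- **Def 3.1 (ii)** for `T = TF`: `(Π ↷ M)` is an **MLF-Galois `TF`-pair** if "for some model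
MLF-Galois `T`-pair `(Π_k ↷ M_k̄)` there exist an isomorphism of topological groups `Π_k ⥲ Π`
and an isomorphism of objects `M_k̄ ⥲ M` of `T` that are compatible with the respective actions".
[cite: MochizukiAbsTopIII2015, Definition 3.1 (ii) p.67] -/
@[mk_iff]
structure IsMLFGaloisFieldPair (P : GaloisFieldPair.{u}) : Prop where
  exists_model : ∃ (C : MLFClosure.{u}) (D : ModelMLFGaloisData C.k C.K),
    Nonempty (GaloisFieldPair.Iso D.fieldPair P)

/-- **Def 3.1 (ii)** for `T ∈ {TCG, TLG, TM}`: `(Π ↷ M)` is an **MLF-Galois `T`-pair** if it is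
isomorphic (compatibly with the actions) to the model `T`-pair of some model data.
[cite: MochizukiAbsTopIII2015, Definition 3.1 (ii) p.67] -/
@[mk_iff]
structure IsMLFGaloisMonoidPair (T : PairType) (P : GaloisMonoidPair.{u}) : Prop where
  exists_model : ∃ (C : MLFClosure.{u}) (D : ModelMLFGaloisData C.k C.K) (Q : GaloisMonoidPair),
    D.monoidPair T = some Q ∧ Nonempty (GaloisMonoidPair.Iso Q P)

/-- **Def 3.1 (ii), "of mono-analytic type"**: the pair admits a model in which "the surjection
`Π_k ↠ G_k` is an isomorphism" — of topological groups: `ε_k` bijective AND open (a bijective continuous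
surjection need not be open).  ("Of hyperbolic orbicurve type" /
"of strictly Belyi type" — `Π_k ↠ G_k` arises from the étale fundamental group of a hyperbolic
orbicurve (of strictly Belyi type) over `k` — quote the scheme-theoretic origin and are typed
over the π₁-interface of seat abc-iut-L4-t1 in the Kummer-map file; TODO-merge abc-iut-L4-t1.)
[cite: MochizukiAbsTopIII2015, Definition 3.1 (ii) p.67] -/
@[mk_iff]
structure IsOfMonoAnalyticTypeField (P : GaloisFieldPair.{u}) : Prop where
  exists_model : ∃ (C : MLFClosure.{u}) (D : ModelMLFGaloisData C.k C.K),
    (Function.Bijective D.aug ∧ IsOpenMap D.aug) ∧ Nonempty (GaloisFieldPair.Iso D.fieldPair P)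

/-- **Def 3.1 (ii), "of mono-analytic type"** for `T ∈ {TCG, TLG, TM}`. [cite: MochizukiAbsTopIII2015, Definition 3.1 (ii) p.67] -/
@[mk_iff]
structure IsOfMonoAnalyticTypeMonoid (T : PairType) (P : GaloisMonoidPair.{u}) : Prop where
  exists_model : ∃ (C : MLFClosure.{u}) (D : ModelMLFGaloisData C.k C.K) (Q : GaloisMonoidPair),
    (Function.Bijective D.aug ∧ IsOpenMap D.aug) ∧ D.monoidPair T = some Q ∧
      Nonempty (GaloisMonoidPair.Iso Q P)

/-- The **arithmetic Galois group** of a pair, in kernel form: "the quotient `Π ↠ G` determined by the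
action of `Π` on `M`". [cite: MochizukiAbsTopIII2015, Definition 3.1 (ii) p.67] -/
def GaloisMonoidPair.actionKer (P : GaloisMonoidPair.{u}) : Subgroup P.Pi :=
  (MulDistribMulAction.toMulAut P.Pi P.M).ker

/-- The arithmetic Galois group (kernel form) of a `TF`-pair. [cite: MochizukiAbsTopIII2015, Definition 3.1 (ii) p.67] -/
def GaloisFieldPair.actionKer (P : GaloisFieldPair.{u}) : Subgroup P.Pi :=
  (MulSemiringAction.toRingAut P.Pi P.M).ker

/-- **Def 3.1 (ii), morphism of MLF-Galois `T`-pairs** `φ : (Π₁ ↷ M₁) → (Π₂ ↷ M₂)` for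
`T ∈ {TCG, TLG, TM}`: "a morphism of objects `φ_M : M₁ → M₂` of `T`, together with a compatible
continuous homomorphism `φ_Π : Π₁ → Π₂` that induces an open injective homomorphism between the
respective arithmetic Galois groups" (open injective: typed on the kernel-quotients as
`φ_Π⁻¹(ker₂) = ker₁` [injective] and the image of every open subgroup has open saturation
[open]).
[cite: MochizukiAbsTopIII2015, Definition 3.1 (ii) p.67] -/
structure GaloisMonoidPair.Hom (P Q : GaloisMonoidPair.{u}) : Type u where
  homPi : P.Pi →* Q.Pi
  continuous_homPi : Continuous homPi
  homM : P.M →* Q.M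
  smul_comm : ∀ (g : P.Pi) (x : P.M), homM (g • x) = homPi g • homM x
  comap_ker : Q.actionKer.comap homPi = P.actionKer
  isOpen_image : ∀ U : Subgroup P.Pi, IsOpen (U : Set P.Pi) →
    IsOpen ((U.map homPi ⊔ Q.actionKer : Subgroup Q.Pi) : Set Q.Pi)

/-- **Def 3.1 (ii), morphism of MLF-Galois `TF`-pairs.** [cite: MochizukiAbsTopIII2015, Definition 3.1 (ii) p.67] -/
structure GaloisFieldPair.Hom (P Q : GaloisFieldPair.{u}) : Type u where
  homPi : P.Pi →* Q.Pi
  continuous_homPi : Continuous homPi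
  homM : P.M →+* Q.M
  smul_comm : ∀ (g : P.Pi) (x : P.M), homM (g • x) = homPi g • homM x
  comap_ker : Q.actionKer.comap homPi = P.actionKer
  isOpen_image : ∀ U : Subgroup P.Pi, IsOpen (U : Set P.Pi) →
    IsOpen ((U.map homPi ⊔ Q.actionKer : Subgroup Q.Pi) : Set Q.Pi)

/-- A morphism is a **`T`-isomorphism** if `φ_M` is an isomorphism. [cite: MochizukiAbsTopIII2015, Definition 3.1 (ii) p.67] -/
def GaloisMonoidPair.Hom.IsTIso {P Q : GaloisMonoidPair.{u}} (φ : P.Hom Q) : Prop :=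
  Function.Bijective φ.homM

/-- A morphism is a **Galois-isomorphism** if `φ_Π` is an isomorphism of topological groups (bijective
and open). [cite: MochizukiAbsTopIII2015, Definition 3.1 (ii) p.67] -/
def GaloisMonoidPair.Hom.IsGaloisIso {P Q : GaloisMonoidPair.{u}} (φ : P.Hom Q) : Prop :=
  Function.Bijective φ.homPi ∧ IsOpenMap φ.homPi

/-- `T`-isomorphism, `TF` case. [cite: MochizukiAbsTopIII2015, Definition 3.1 (ii) p.67] -/
def GaloisFieldPair.Hom.IsTIso {P Q : GaloisFieldPair.{u}} (φ : P.Hom Q) : Prop :=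
  Function.Bijective φ.homM

/-- Galois-isomorphism, `TF` case. [cite: MochizukiAbsTopIII2015, Definition 3.1 (ii) p.67] -/
def GaloisFieldPair.Hom.IsGaloisIso {P Q : GaloisFieldPair.{u}} (φ : P.Hom Q) : Prop :=
  Function.Bijective φ.homPi ∧ IsOpenMap φ.homPi

/-! ### Definition 3.1 (iv): the output of the log-Frobenius operation on pairs -/

section LogFrobenius

variable {k : Type u} [Field k] [ValuativeRel k] {K : Type u} [Field K] [Algebra k K]

/-- **Def 3.1 (iv): the log-Frobenius operation on model `TF`-pairs**, in the coordinates given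
by `log_k̄`: the model pair `(Π_k ↷ k̄)` is sent to the pair `(Π_k ↷ k~)`, and `log_k̄` is an
isomorphism of `TF`-pairs `(Π_k ↷ k~) ⥲ (Π_k ↷ k̄)` ("since `log_k̄` determines a functorial
isomorphism between the fields `k̄`, `k~`, it follows immediately that the functor `𝔩𝔬𝔤_{TF,TF}`
is isomorphic to the identity functor").  What is NOT an isomorphism invariant is the extra
datum carried by the output: the pre-log-shell.  We therefore type the output of the operation
as the pair together with its compactum.
[cite: MochizukiAbsTopIII2015, Definition 3.1 (iv) pp.68–69] -/
structure LogFrobeniusOutput (k : Type u) [Field k] [ValuativeRel k] (K : Type u) [Field K]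
    [Algebra k K] [Algebra.IsAlgebraic k K] : Type (u + 1) where
  data : ModelMLFGaloisData k K
  log : GaloisPadicLog k K

/-- The output `TF`-pair `(Π_k ↷ k~)` — in `log`-coordinates the model pair itself.
[cite: MochizukiAbsTopIII2015, Definition 3.1 (iv) pp.68–69] -/
def LogFrobeniusOutput.pair [Algebra.IsAlgebraic k K] (O : LogFrobeniusOutput k K) :
    GaloisFieldPair.{u} := O.data.fieldPair

/-- Its compactum, the pre-log-shell `λ ⊆ k~`. [cite: MochizukiAbsTopIII2015, Definition 3.1 (iv) p.69] -/
def LogFrobeniusOutput.shell [Algebra.IsAlgebraic k K] (O : LogFrobeniusOutput k K) : AddSubgroup K :=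
  O.log.preLogShell

end LogFrobenius

end

end Literature.AnabelianGeometry.AbsoluteAnabelian
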